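import Literature.Computability.Cryptography.LWE
import HarnessLib

/-!
# The LWE distribution: discharges of named facts (trunk T-LATTICE, G10)

Sibling "proofs" file of `Literature/Computability/Cryptography/LWE.lean` (which, containing
definitions, is review-gated; proofs live here).  It discharges named facts of that file that follow
from Mathlib alone; the facts stay `def … : Prop` there and their users' hypotheses `(h : X)` are fed
`X_holds` from here.

## Content

* `Literature.LWE.searchSuccessProb_le_one_holds : searchSuccessProb_le_one` — the average-case success
  probability of a search-LWE solver is at most `1`: it is the average, against the uniform `PMF` on
  secrets, of per-secret success probabilities, each a `PMF` mass and hence `≤ 1`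
  (`searchSuccessProbOf_le_one`), so it is `≤ ∑ s, U(s) = 1` (`PMF.tsum_coe`).
* `Literature.LWE.iidPMF_apply_holds : iidPMF_apply` — the product formula `iidPMF p m v = ∏ i, p (v i)` for
  the `m`-fold iid product of a `PMF` (Regev 2009, §2: "`m` independent samples from `A_{s,χ}`").
* `Literature.LWE.uniformSamples_eq_iidPMF_holds : uniformSamples_eq_iidPMF` — the uniform distribution on
  `m`-tuples of samples is the `m`-fold iid product of the uniform distribution on one sample (Regev
  2009, §4: the reference distribution of decision-LWE is "samples from `U`", `U` uniform on
  `Z_q^n × Z_q`).  Both are elementary (induction on `m` through the `bind`/`map` recursion defining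
  `iidPMF`; then a cardinality count `|β^m|⁻¹ = (|β|⁻¹)^m`).  Mathlib has no product `PMF` (nothing in
  `Mathlib/Probability/ProbabilityMassFunction/`), hence no ready-made lemma.
* `Literature.Computability.Cryptography.LWE.toReal_acceptProb_le_one`, `Literature.Computability.Cryptography.LWE.abs_toReal_acceptProb_sub_le_one`,
  `Literature.Computability.Cryptography.LWE.distinguishingAdvantageOf_le_one` and
  `Literature.LWE.distinguishingAdvantage_le_one_holds : distinguishingAdvantage_le_one` — the (average-case)
  decision-LWE distinguishing advantage `|Pr_{s ← U}[D(A_{s,χ}^m) accepts] - Pr[D(U^m) accepts]|` of any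
  distinguisher `D` (and likewise the per-secret advantage) is at most `1` (Peikert 2016, §4.2,
  Def. 4.2.3: the decision-LWE experiment; §2.3: "advantage" as the attacker's measure of success).  The
  proof is the one-line observation implicit in the source: both acceptance probabilities are masses of
  a `PMF` (`PMF.coe_le_one`), hence lie in `[0, 1]` after `ENNReal.toReal`, so their difference has
  absolute value at most `1`.  The bound is not a numbered result in the source; it is immediate from
  Def. 4.2.3.
* `Literature.Computability.Cryptography.LWE.toReal_acceptProb_lweSamplesUniformSecret` and
  `Literature.LWE.distinguishingAdvantage_le_sum_holds : distinguishingAdvantage_le_sum` — the average-case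
  advantage is at most the average, over a uniform secret `s`, of the per-secret advantages:
  `|E_s[p_s] - q| ≤ E_s |p_s - q|` with `p_s = Pr[D(A_{s,χ}^m) accepts]`, `q = Pr[D(U^m) accepts]`
  (Peikert 2016, §4.2, Def. 4.2.3: in decision-LWE the secret `s ∈ Z_q^n` is uniformly random, so the
  acceptance probability in case (1) is the average `E_s[p_s]` — this is the first lemma, by associativity
  of `PMF.bind`; the bound is then the triangle inequality for the finite average, using `∑ s, U(s) = 1`).
  Not a numbered result in the source; it is the averaging step implicit in Def. 4.2.3.

## References

* O. Regev, *On lattices, learning with errors, random linear codes, and cryptography*, J. ACM 56 (2009)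
  (STOC 2005), art. 34, §2 and §4 (p. 25 of the held text: the search / decision LWE experiments and
  their success / acceptance probabilities). [cite: RegevLWE2009, §4]
* C. Peikert, *A decade of lattice cryptography*, Found. Trends TCS 10 (2016), §2.3 (p. 12 of the
  monograph pagination: advantage) and §4.2, Def. 4.2.3 (p. 24: Decision-LWE). [cite: PeikertDecade2016, §4.2]
-/

noncomputable section

open scoped ENNReal

namespace Literature.Computability.Cryptography

namespace LWE

variable {ι : Type} [Fintype ι] [DecidableEq ι]
variable {R : Type} [CommRing R] [Fintype R]

/-! ### Search-LWE: the average-case success probability is at most `1` -/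

/-- Discharge of `searchSuccessProb_le_one`: the average over a uniform secret `s` of the per-secret
success probabilities `Pr[A(A_{s,χ}^m) = s]`, each at most `1` (`searchSuccessProbOf_le_one`), is at most
`∑ s, U(s) = 1` (Regev 2009 §4, p. 25: success/acceptance probabilities of the search and decision LWE
experiments are probabilities). [cite: RegevLWE2009, §4 (search/decision LWE experiments)] -/
theorem searchSuccessProb_le_one_holds : searchSuccessProb_le_one (ι := ι) (R := R) := by
  intro χ m A
  unfold searchSuccessProb
  calc ∑ s, PMF.uniformOfFintype (ι → R) s * searchSuccessProbOf χ m A s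
      ≤ ∑ s, PMF.uniformOfFintype (ι → R) s * 1 := by
        gcongr with s
        exact searchSuccessProbOf_le_one χ m A s
    _ = 1 := by
        simp only [mul_one]
        rw [← tsum_fintype (L := SummationFilter.unconditional _)]
        exact (PMF.uniformOfFintype (ι → R)).tsum_coe

/-! ### iid products: product formula, and the uniform reference distribution as an iid product -/

/-- Discharge of the named fact `iidPMF_apply` (product formula for the iid product): the tuple `v`
has mass `∏ i, p (v i)` under `iidPMF p m`.  By induction on `m`: in the `bind`/`map` unfolding of
`iidPMF p (m + 1)` only the term `x = v 0`, `w = Fin.tail v` contributes (`Fin.cons` is injective),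
giving `p (v 0) * iidPMF p m (Fin.tail v)`, and `Fin.prod_univ_succ` closes.  This is the defining
property of "`m` independent samples" (Regev 2009 §2). [cite: RegevLWE2009, §2 (m independent samples)] -/
theorem iidPMF_apply_holds : iidPMF_apply := by
  intro α p m
  induction m with
  | zero =>
    intro v
    rw [iidPMF_zero, PMF.pure_apply, Fin.prod_univ_zero, if_pos (Subsingleton.elim _ _)]
  | succ m ih =>
    intro v
    rw [iidPMF_succ, PMF.bind_apply, Fin.prod_univ_succ, tsum_eq_single (v 0)]
    · rw [PMF.map_apply, tsum_eq_single (Fin.tail v)]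
      · rw [if_pos (Fin.cons_self_tail v).symm, ih]
        rfl
      · intro w hw
        rw [if_neg]
        intro h
        exact hw (by rw [h, Fin.tail_cons])
    · intro x hx
      rw [PMF.map_apply, ENNReal.tsum_eq_zero.mpr, mul_zero]
      intro w
      rw [if_neg]
      intro h
      exact hx (by rw [h, Fin.cons_zero])

/-- Discharge of the named fact `uniformSamples_eq_iidPMF`: the uniform distribution on `m`-tuples of
samples equals the `m`-fold iid product of the uniform distribution on one sample, i.e. "`m` samples from
`U`" (Regev 2009 §4, the reference distribution of decision-LWE) is `U` on `(Z_q^n × Z_q)^m`.  Both sides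
give every tuple the mass `|β|^{-m}`, `β = (ι → R) × R` (`iidPMF_apply_holds`, `Fintype.card_fun`).
[cite: RegevLWE2009, §4 (samples from the uniform distribution U)] -/
theorem uniformSamples_eq_iidPMF_holds : uniformSamples_eq_iidPMF (ι := ι) (R := R) := by
  intro m
  ext v
  rw [uniformSamples, PMF.uniformOfFintype_apply, iidPMF_apply_holds]
  simp only [PMF.uniformOfFintype_apply, Finset.prod_const, Finset.card_univ, Fintype.card_fin,
    Fintype.card_fun, Nat.cast_pow, ENNReal.inv_pow]

/-! ### Decision-LWE: the distinguishing advantage is at most `1` -/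

/-- An acceptance probability, read as a real number, is at most `1`. [folklore] -/
theorem toReal_acceptProb_le_one {β : Type} (D : β → PMF Bool) (P : PMF β) :
    (acceptProb D P).toReal ≤ 1 :=
  ENNReal.toReal_le_of_le_ofReal zero_le_one (by simpa using acceptProb_le_one D P)

/-- The absolute difference of two acceptance probabilities is at most `1`. [folklore] -/
theorem abs_toReal_acceptProb_sub_le_one {β γ : Type} (D : β → PMF Bool) (P : PMF β)
    (D' : γ → PMF Bool) (Q : PMF γ) :
    |(acceptProb D P).toReal - (acceptProb D' Q).toReal| ≤ 1 := by
  have h1 := toReal_acceptProb_le_one D P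
  have h2 := toReal_acceptProb_le_one D' Q
  have h1' : 0 ≤ (acceptProb D P).toReal := ENNReal.toReal_nonneg
  have h2' : 0 ≤ (acceptProb D' Q).toReal := ENNReal.toReal_nonneg
  rw [abs_sub_le_iff]
  constructor <;> linarith

/-- The per-secret (worst-case-in-`s`) decision-LWE advantage is at most `1` (Regev 2009 §4; Peikert 2016
Def. 4.2.3). [cite: PeikertDecade2016, §4.2 Def. 4.2.3] -/
theorem distinguishingAdvantageOf_le_one (χ : PMF R) (m : ℕ) (D : Distinguisher ι R m) (s : ι → R) :
    distinguishingAdvantageOf χ m D s ≤ 1 :=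
  abs_toReal_acceptProb_sub_le_one D _ D _

/-- Discharge of `distinguishingAdvantage_le_one`: the (average-case) decision-LWE advantage of any
distinguisher is at most `1`, both acceptance probabilities in Def. 4.2.3 lying in `[0, 1]`
(Peikert 2016, §4.2, Def. 4.2.3, p. 24; "advantage", §2.3, p. 12). [cite: PeikertDecade2016, §4.2 Def. 4.2.3] -/
theorem distinguishingAdvantage_le_one_holds : distinguishingAdvantage_le_one (ι := ι) (R := R) :=
  fun χ m D ↦ abs_toReal_acceptProb_sub_le_one D (lweSamplesUniformSecret χ m) D (uniformSamples ι R m)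

/-! ### Decision-LWE: the average-case advantage is at most the average per-secret advantage -/

/-- The acceptance probability of `D` in the LWE branch of the decision experiment with a uniformly random
secret is the average over `s` of the per-secret acceptance probabilities:
`Pr_{s ← U}[D(A_{s,χ}^m) accepts] = ∑ s, U(s) · Pr[D(A_{s,χ}^m) accepts]` — associativity of `PMF.bind`
(Peikert 2016, §4.2, Def. 4.2.3, case (1): the samples follow "`A_{s,χ}` for a uniformly random
`s ∈ Z_q^n` (fixed for all samples)"). [cite: PeikertDecade2016, §4.2 (Def. 4.2.3, ePrint p. 24)] -/
theorem acceptProb_lweSamplesUniformSecret (χ : PMF R) (m : ℕ) (D : Distinguisher ι R m) :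
    acceptProb D (lweSamplesUniformSecret χ m)
      = ∑ s, PMF.uniformOfFintype (ι → R) s * acceptProb D (lweSamples χ s m) := by
  unfold acceptProb lweSamplesUniformSecret
  rw [PMF.bind_bind, PMF.bind_apply, tsum_fintype]

/-- Real-valued form of `acceptProb_lweSamplesUniformSecret`: `ENNReal.toReal` commutes with the finite
average (all masses are finite). [folklore] -/
theorem toReal_acceptProb_lweSamplesUniformSecret (χ : PMF R) (m : ℕ) (D : Distinguisher ι R m) :
    (acceptProb D (lweSamplesUniformSecret χ m)).toReal
      = ∑ s, (PMF.uniformOfFintype (ι → R) s).toReal * (acceptProb D (lweSamples χ s m)).toReal := by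
  rw [acceptProb_lweSamplesUniformSecret, ENNReal.toReal_sum]
  · simp_rw [ENNReal.toReal_mul]
  · intro s _
    exact ENNReal.mul_ne_top (PMF.apply_ne_top _ _) (PMF.apply_ne_top _ _)

/-- The uniform `PMF` on secrets has total real mass `1`. [folklore] -/
theorem sum_toReal_uniformOfFintype_secret :
    ∑ s, (PMF.uniformOfFintype (ι → R) s).toReal = 1 := by
  have h := (PMF.uniformOfFintype (ι → R)).tsum_coe
  rw [tsum_fintype] at h
  rw [← ENNReal.toReal_sum fun s _ ↦ PMF.apply_ne_top _ _, h, ENNReal.toReal_one]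

/-- Discharge of `distinguishingAdvantage_le_sum`: the average-case decision-LWE advantage
`|Pr_{s ← U}[D(A_{s,χ}^m) accepts] - Pr[D(U^m) accepts]|` is at most the average over a uniform secret `s`
of the per-secret advantages `|Pr[D(A_{s,χ}^m) accepts] - Pr[D(U^m) accepts]|`, i.e.
`|E_s[p_s] - q| ≤ E_s |p_s - q|`.  Proof: `Pr_{s ← U}[…] = E_s[p_s]` (`acceptProb_lweSamplesUniformSecret`),
`q = ∑ s, U(s) q` since `∑ s, U(s) = 1`, then the triangle inequality for the finite sum
(`Finset.abs_sum_le_sum_abs`) and `|U(s) x| = U(s) |x|`.  This is the averaging step implicit in the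
decision-LWE experiment of Peikert 2016, §4.2, Def. 4.2.3 (secret uniformly random in case (1)); it is not
a numbered result there. [cite: PeikertDecade2016, §4.2 (Def. 4.2.3, ePrint p. 24)] -/
theorem distinguishingAdvantage_le_sum_holds : distinguishingAdvantage_le_sum (ι := ι) (R := R) := by
  intro χ m D
  unfold distinguishingAdvantage distinguishingAdvantageOf
  set q := (acceptProb D (uniformSamples ι R m)).toReal
  calc |(acceptProb D (lweSamplesUniformSecret χ m)).toReal - q|
      = |∑ s, (PMF.uniformOfFintype (ι → R) s).toReal
            * ((acceptProb D (lweSamples χ s m)).toReal - q)| := by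
        rw [toReal_acceptProb_lweSamplesUniformSecret]
        congr 1
        simp_rw [mul_sub]
        rw [Finset.sum_sub_distrib, ← Finset.sum_mul, sum_toReal_uniformOfFintype_secret, one_mul]
    _ ≤ ∑ s, |(PMF.uniformOfFintype (ι → R) s).toReal
            * ((acceptProb D (lweSamples χ s m)).toReal - q)| :=
        Finset.abs_sum_le_sum_abs _ _
    _ = ∑ s, (PMF.uniformOfFintype (ι → R) s).toReal
            * |(acceptProb D (lweSamples χ s m)).toReal - q| := by
        refine Finset.sum_congr rfl fun s _ ↦ ?_
        rw [abs_mul, abs_of_nonneg ENNReal.toReal_nonneg]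

end LWE

end Literature.Computability.Cryptography

end
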